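import Literature.MathematicalPhysics.QuantumFieldTheory.ConformalBootstrap3D.PointKernelK34L515.Cert
import Literature.MathematicalPhysics.QuantumFieldTheory.ConformalBootstrap3D.PointKernel

/-!
# K34L515 — (T) tail domination data at `E_T = 100` (typer-g8)

Dyadic (denominator 2^20) domination ratios `qdL515`, `qrL515` of the nodes against the apex and the
kernel check `certL515.tOK qdL515 qrL515 100` (FEASIBILITY §10: (T) fails at 48 and 80, passes at 100).
-/

set_option Elab.async false

namespace Literature.MathematicalPhysics.QuantumFieldTheory.ConformalBootstrap3D.PointKernelK34L515

open PointKernel PKTM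

/-- direct-channel domination ratios `q_k ≥ max(√(u_k/u_apex), z_k/z_apex)`, rounded up to 2^-20. [folklore] -/
def qdL515 : List ℚ := [((733171 : ℚ)/1048576), ((192239 : ℚ)/262144), ((726475 : ℚ)/1048576), ((191443 : ℚ)/262144), ((803149 : ℚ)/1048576), ((838861 : ℚ)/1048576), ((757305 : ℚ)/1048576), ((757305 : ℚ)/1048576), ((797041 : ℚ)/1048576), ((104493 : ℚ)/131072), ((873115 : ℚ)/1048576), ((454383 : ℚ)/524288), ((101945 : ℚ)/131072), ((101945 : ℚ)/131072), ((101945 : ℚ)/131072), ((103391 : ℚ)/131072), ((216875 : ℚ)/262144), ((453037 : ℚ)/524288), ((943071 : ℚ)/1048576), ((436907 : ℚ)/524288), ((436907 : ℚ)/524288), ((436907 : ℚ)/524288), ((436907 : ℚ)/524288), ((436907 : ℚ)/524288), ((897947 : ℚ)/1048576), ((937875 : ℚ)/1048576), ((233017 : ℚ)/262144), ((233017 : ℚ)/262144), ((233017 : ℚ)/262144), ((233017 : ℚ)/262144), ((233017 : ℚ)/262144), ((233017 : ℚ)/262144), ((233017 : ℚ)/262144), (1 : ℚ)]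

/-- reflected-channel domination ratios, rounded up to 2^-20. [folklore] -/
def qrL515 : List ℚ := [((331589 : ℚ)/524288), ((314573 : ℚ)/524288), ((81971 : ℚ)/131072), ((312625 : ℚ)/524288), ((593165 : ℚ)/1048576), ((559241 : ℚ)/1048576), ((699051 : ℚ)/1048576), ((640797 : ℚ)/1048576), ((146217 : ℚ)/262144), ((554855 : ℚ)/1048576), ((261561 : ℚ)/524288), ((61167 : ℚ)/131072), ((757305 : ℚ)/1048576), ((699051 : ℚ)/1048576), ((640797 : ℚ)/1048576), ((582543 : ℚ)/1048576), ((1 : ℚ)/2), ((484317 : ℚ)/1048576), ((453037 : ℚ)/1048576), ((101945 : ℚ)/131072), ((757305 : ℚ)/1048576), ((699051 : ℚ)/1048576), ((640797 : ℚ)/1048576), ((582543 : ℚ)/1048576), ((1 : ℚ)/2), ((233017 : ℚ)/524288), ((436907 : ℚ)/524288), ((101945 : ℚ)/131072), ((757305 : ℚ)/1048576), ((699051 : ℚ)/1048576), ((640797 : ℚ)/1048576), ((582543 : ℚ)/1048576), ((1 : ℚ)/2), ((436907 : ℚ)/1048576)]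

/-- **(T) at `E_T = 100`** for the K34L515 certificate. [cite: HogervorstRychkov2013, §3 eq. (3.6)] -/
theorem certL515_tOK100 : certL515.tOK qdL515 qrL515 100 = true := by
  decide +kernel

end Literature.MathematicalPhysics.QuantumFieldTheory.ConformalBootstrap3D.PointKernelK34L515
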